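import Summits.SmoothPoincare4.SmoothPoincare4.Theses.EntropyRung
import Literature.Geometry.Riemannian.ShrinkingRoundSphereFour
import Literature.Geometry.Riemannian.GaussianShrinker
import Mathlib.MeasureTheory.Group.Measure
import Literature.Geometry.Riemannian.RicciFlowScaling
import Literature.Geometry.Riemannian.VolumeScaling
import Literature.Geometry.Riemannian.RoundSphereVolume
import Literature.Geometry.Riemannian.ChangGurskyYangProofs

/-!
# drefute checks for line `cgy-variance-pivot` (crux stmt-SmoothPoincare4-10870 `CompactShrinkerGap`)

Lean-checked instance / mutation checks of the registered stubs of
`Cruxes/CompactShrinkerGap/Lines/cgy-variance-pivot.lean` (refuter-drefute seat).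

* `stub4WithoutCompact_false` — `stub_scalarCurvaturePos_of_identities` with `[CompactSpace M]`
  dropped is FALSE: the Gaussian shrinker `(ℝ⁴, δ, |x|²/4)` satisfies the soliton equation and the
  pointwise identity (B) (all terms vanish) but has `R ≡ 0`. So closedness is load-bearing there.
* `stub7WithoutCompact_false` — `stub_jensenVolumeBound` with `[CompactSpace M]` dropped is FALSE:
  for the Gaussian shrinker `∫ e^{-f} dx = 16π²` while `e^{-2} · Vol(ℝ⁴).toReal = e^{-2} · ∞.toReal = 0`.
* `identityB_round` — NON-VACUITY of the hypothesis (B) of stubs 3 and 4 at the round shrinker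
  `S⁴(√6)`: `□R = 0 = g⁻¹(dR, df) + R − 2|Ric|² = 0 + 2 − 2·1` (sign/normalisation check of
  `dalembertian`, `innerDual`, `normSq` against the Einstein model).
* `stub1WithoutSoliton_false` — `stub_varianceBudget` with the soliton equation dropped is FALSE on the
  standard `S⁴` (`36·g_rd`, `f ≡ R ≡ 1/3`): the transfer target is not shielded by SPC4.
* `stub3_conclusion_round` — STUB 3's conclusion `∫σ₂ = V/6 − D/12` holds at `S⁴(√6)` (`σ₂ ≡ 1/6`).
-/

noncomputable section

open scoped Manifold ContDiff ENNReal Topology RealInnerProductSpace ContinuousMap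
open MeasureTheory Set Bundle
open Literature.Geometry.Riemannian Literature.Geometry.Lorentzian
open Literature.Geometry.Lorentzian.PseudoRiemannianMetric

namespace Summit.SmoothPoincare4.SmoothPoincare4.Cruxes.CompactShrinkerGap.DrefuteCgyVariancePivot

set_option linter.unusedVariables false
set_option linter.dupNamespace false

/-- `□ c = 0` for a constant function (trace of `hessian_constFun`). [folklore] -/
theorem dalembertian_constFun {M : Type*} [TopologicalSpace M] [ChartedSpace (EuclideanSpace ℝ (Fin 4)) M]
    [IsManifold (𝓡 4) ∞ M]
    (g : PseudoRiemannianMetric (𝓡 4) ∞ (EuclideanSpace ℝ (Fin 4)) (TangentSpace (𝓡 4) : M → Type _))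
    [g.HasLeviCivita] (c : ℝ) (x : M) : g.dalembertian (fun _ ↦ c) x = 0 := by
  simp [PseudoRiemannianMetric.dalembertian, hessian_constFun, PseudoRiemannianMetric.trace]

/-- `(c • B)ᵗ = c • Bᵗ`. [folklore] -/
theorem flip_smul_bilin {V : Type*} [AddCommGroup V] [Module ℝ V] (c : ℝ) (B : LinearMap.BilinForm ℝ V) :
    (c • B).flip = c • B.flip := by
  ext v w
  simp

/-! ## Stub 4 without compactness -/

/-- `stub_scalarCurvaturePos_of_identities` with the binder `[CompactSpace M]` deleted, everything
else verbatim. [folklore] -/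
def Stub4WithoutCompact : Prop :=
  ∀ (M : Type) [TopologicalSpace M] [T2Space M] [SecondCountableTopology M]
    [ChartedSpace (EuclideanSpace ℝ (Fin 4)) M] [IsManifold (𝓡 4) ∞ M]
    (g : PseudoRiemannianMetric (𝓡 4) ∞ (EuclideanSpace ℝ (Fin 4)) (TangentSpace (𝓡 4) : M → Type _))
    [g.HasLeviCivita] (f : M → ℝ), g.IsRiemannian →
    ContMDiff (𝓡 4) 𝓘(ℝ, ℝ) ∞ f →
    (∀ (x : M) (X Y : TangentSpace (𝓡 4) x),
      g.ricci x X Y + g.hessian f x X Y = (1 / 2 : ℝ) * g.val x X Y) →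
    (∀ x : M, g.dalembertian g.scalarCurvature x =
      g.innerDual x (mvfderiv (𝓡 4) g.scalarCurvature x : TangentSpace (𝓡 4) x →ₗ[ℝ] ℝ)
          (mvfderiv (𝓡 4) f x : TangentSpace (𝓡 4) x →ₗ[ℝ] ℝ) +
        g.scalarCurvature x - 2 * g.normSq x (g.ricci x)) →
    ∀ x : M, 0 < g.scalarCurvature x

/-- The Gaussian shrinker solves `Ric + Hess f = ½ δ` (copied from `Disproof.hyps_gaussian`). [folklore] -/
theorem soliton_gaussian (x : EuclideanFour) (X Y : TangentSpace (𝓡 4) x) :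
    (euclideanMetric EuclideanFour).ricci x X Y + (euclideanMetric EuclideanFour).hessian gaussianPotential x X Y =
      (1 / 2 : ℝ) * (euclideanMetric EuclideanFour).val x X Y := by
  rw [ricci_euclideanMetric, hessian_gaussianPotential, euclideanMetric_apply]
  simp only [LinearMap.zero_apply, zero_add]
  rw [div_eq_inv_mul, one_div]
  rfl

/-- The scalar curvature FUNCTION of Euclidean `ℝ⁴` is the zero function. [folklore] -/
theorem scalarCurvature_euclideanFour_eq :
    (euclideanMetric EuclideanFour).scalarCurvature = fun _ ↦ (0 : ℝ) :=
  funext fun x ↦ scalarCurvature_euclideanMetric x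

/-- Identity (B) holds for the Gaussian shrinker: every term vanishes. [folklore] -/
theorem identityB_gaussian (x : EuclideanFour) :
    (euclideanMetric EuclideanFour).dalembertian (euclideanMetric EuclideanFour).scalarCurvature x =
      (euclideanMetric EuclideanFour).innerDual x
          (mvfderiv (𝓡 4) (euclideanMetric EuclideanFour).scalarCurvature x :
            TangentSpace (𝓡 4) x →ₗ[ℝ] ℝ)
          (mvfderiv (𝓡 4) gaussianPotential x : TangentSpace (𝓡 4) x →ₗ[ℝ] ℝ) +
        (euclideanMetric EuclideanFour).scalarCurvature x -
        2 * (euclideanMetric EuclideanFour).normSq x ((euclideanMetric EuclideanFour).ricci x) := by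
  rw [scalarCurvature_euclideanFour_eq, dalembertian_constFun, mvfderiv_const, ricci_euclideanMetric]
  simp [PseudoRiemannianMetric.innerDual, PseudoRiemannianMetric.normSq]

/-- **`stub_scalarCurvaturePos_of_identities` minus `[CompactSpace M]` is FALSE** (witness: the
Gaussian shrinker, `R ≡ 0`). Any proof of stub 4 must use closedness. [folklore] -/
theorem stub4WithoutCompact_false : ¬ Stub4WithoutCompact := by
  intro h
  have h0 := h EuclideanFour (euclideanMetric EuclideanFour) gaussianPotential isRiemannian_euclideanMetric
    contDiff_gaussianPotential.contMDiff soliton_gaussian identityB_gaussian 0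
  rw [scalarCurvature_euclideanMetric] at h0
  exact lt_irrefl _ h0

/-! ## Stub 7 without compactness -/

/-- `stub_jensenVolumeBound` with the binder `[CompactSpace M]` deleted, everything else verbatim. [folklore] -/
def Stub7WithoutCompact : Prop :=
  ∀ (M : Type) [TopologicalSpace M] [T2Space M] [SecondCountableTopology M]
    [ChartedSpace (EuclideanSpace ℝ (Fin 4)) M] [IsManifold (𝓡 4) ∞ M]
    [T3Space M] [MeasurableSpace M] [BorelSpace M]
    (g : PseudoRiemannianMetric (𝓡 4) ∞ (EuclideanSpace ℝ (Fin 4)) (TangentSpace (𝓡 4) : M → Type _))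
    [g.HasLeviCivita] (f : M → ℝ) (hg : g.IsRiemannian),
    ContMDiff (𝓡 4) 𝓘(ℝ, ℝ) ∞ f →
    (∀ (x : M) (X Y : TangentSpace (𝓡 4) x),
      g.ricci x X Y + g.hessian f x X Y = (1 / 2 : ℝ) * g.val x X Y) →
    (∀ x : M, g.scalarCurvature x + g.gradSq f x = f x) →
    (∫ x, Real.exp (-f x) ∂(riemannianMeasure (g.toContMDiffRiemannianMetric hg))) ≤
      Real.exp (-2) * ((riemannianMeasure (g.toContMDiffRiemannianMetric hg)) Set.univ).toReal

/-- Normalisation `R + |∇f|² = f` for the Gaussian shrinker. [folklore] -/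
theorem normalisation_gaussian (x : EuclideanFour) :
    (euclideanMetric EuclideanFour).scalarCurvature x +
      (euclideanMetric EuclideanFour).gradSq gaussianPotential x = gaussianPotential x := by
  rw [scalarCurvature_euclideanMetric, gradSq_gaussianPotential, zero_add]

/-- `Vol(ℝ⁴) = ∞` for Lebesgue measure. [folklore] -/
theorem volume_univ_euclideanFour : (volume : Measure EuclideanFour) univ = ⊤ :=
  measure_univ_of_isAddLeftInvariant _

/-- **`stub_jensenVolumeBound` minus `[CompactSpace M]` is FALSE** (witness: the Gaussian
shrinker, `∫ e^{-f} = 16π² > 0 = e^{-2} · (∞).toReal`). [folklore] -/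
theorem stub7WithoutCompact_false : ¬ Stub7WithoutCompact := by
  intro h
  have h0 := h EuclideanFour (euclideanMetric EuclideanFour) gaussianPotential isRiemannian_euclideanMetric
    contDiff_gaussianPotential.contMDiff soliton_gaussian normalisation_gaussian
  change (∫ x, Real.exp (-gaussianPotential x) ∂(riemannianMeasure euclideanFourMetric)) ≤
      Real.exp (-2) * ((riemannianMeasure euclideanFourMetric) Set.univ).toReal at h0
  rw [riemannianMeasure_euclideanFour, integral_exp_neg_gaussianPotential, volume_univ_euclideanFour,
    ENNReal.toReal_top, mul_zero] at h0
  have : (0 : ℝ) < 16 * Real.pi ^ 2 := by positivity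
  linarith

/-! ## Non-vacuity of identity (B) at the round shrinker `S⁴(√6)` -/

/-- `♯ ∘ ♭ = id` as linear maps. [folklore] -/
theorem sharp_comp_toBilinForm (x : SphereFour) :
    (shrinkingSphereFourMetric.sharp x).toLinearMap ∘ₗ shrinkingSphereFourMetric.toBilinForm x = LinearMap.id := by
  refine LinearMap.ext fun v ↦ ?_
  exact shrinkingSphereFourMetric.sharp_flat x v

/-- The metric, as a bilinear form, equals its flip (symmetry). [folklore] -/
theorem toBilinForm_flip (x : SphereFour) :
    (shrinkingSphereFourMetric.toBilinForm x).flip = shrinkingSphereFourMetric.toBilinForm x := by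
  refine LinearMap.ext₂ fun v w ↦ ?_
  exact shrinkingSphereFourMetric.symm x w v

/-- `|g|²_g = 4` on a `4`-manifold: `normSq` of the metric itself is the dimension. [folklore] -/
theorem normSq_toBilinForm_sphereFour (x : SphereFour) :
    shrinkingSphereFourMetric.normSq x (shrinkingSphereFourMetric.toBilinForm x) = 4 := by
  rw [PseudoRiemannianMetric.normSq, toBilinForm_flip, sharp_comp_toBilinForm]
  haveI : Module.Finite ℝ (TangentSpace (𝓡 4) x) := inferInstanceAs (Module.Finite ℝ (EuclideanSpace ℝ (Fin 4)))
  haveI : Module.Free ℝ (TangentSpace (𝓡 4) x) := inferInstanceAs (Module.Free ℝ (EuclideanSpace ℝ (Fin 4)))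
  rw [LinearMap.id_comp, LinearMap.trace_id]
  have : Module.finrank ℝ (TangentSpace (𝓡 4) x) = 4 := finrank_euclideanSpace_fin
  rw [this]
  norm_num

/-- `Ric = ½ g` as bilinear forms on `S⁴(√6)`. [folklore] -/
theorem ricci_shrinkingSphereFour_eq (x : SphereFour) :
    shrinkingSphereFourMetric.ricci x = (1 / 2 : ℝ) • shrinkingSphereFourMetric.toBilinForm x := by
  refine LinearMap.ext₂ fun v w ↦ ?_
  rw [ricci_shrinkingSphereFourMetric, LinearMap.smul_apply, LinearMap.smul_apply, toBilinForm_apply, smul_eq_mul]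

/-- `|Ric|² = 1` on `S⁴(√6)` (`= ¼ |g|² = ¼ · 4`). [folklore] -/
theorem normSq_ricci_shrinkingSphereFour (x : SphereFour) :
    shrinkingSphereFourMetric.normSq x (shrinkingSphereFourMetric.ricci x) = 1 := by
  rw [ricci_shrinkingSphereFour_eq]
  have h4 := normSq_toBilinForm_sphereFour x
  rw [PseudoRiemannianMetric.normSq] at h4 ⊢
  rw [flip_smul_bilin]
  simp only [LinearMap.comp_smul, LinearMap.smul_comp, map_smul, smul_eq_mul]
  rw [h4]
  norm_num

/-- The scalar curvature FUNCTION of `S⁴(√6)` is the constant `2`. [folklore] -/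
theorem scalarCurvature_shrinkingSphereFour_eq :
    shrinkingSphereFourMetric.scalarCurvature = fun _ ↦ (2 : ℝ) :=
  funext scalarCurvature_shrinkingSphereFourMetric

/-- **NON-VACUITY of hypothesis (B) of stubs 3/4 at the round shrinker** `(S⁴(√6), f ≡ 2)`:
`□R = g⁻¹(dR, df) + R − 2|Ric|²` reads `0 = 0 + 2 − 2`. [folklore] -/
theorem identityB_round (x : SphereFour) :
    shrinkingSphereFourMetric.dalembertian shrinkingSphereFourMetric.scalarCurvature x =
      shrinkingSphereFourMetric.innerDual x
          (mvfderiv (𝓡 4) shrinkingSphereFourMetric.scalarCurvature x : TangentSpace (𝓡 4) x →ₗ[ℝ] ℝ)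
          (mvfderiv (𝓡 4) (fun _ : SphereFour ↦ (2 : ℝ)) x : TangentSpace (𝓡 4) x →ₗ[ℝ] ℝ) +
        shrinkingSphereFourMetric.scalarCurvature x -
        2 * shrinkingSphereFourMetric.normSq x (shrinkingSphereFourMetric.ricci x) := by
  rw [normSq_ricci_shrinkingSphereFour, scalarCurvature_shrinkingSphereFour_eq, dalembertian_constFun,
    mvfderiv_const]
  simp only [PseudoRiemannianMetric.innerDual, ContinuousLinearMap.toLinearMap_zero, LinearMap.zero_apply]
  norm_num


/-! ## Stub 1 without the soliton equation -/

/-- `stub_varianceBudget` with the soliton equation `Ric + Hess f = g/2` deleted, everything else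
verbatim. [folklore] -/
def Stub1WithoutSoliton : Prop :=
  ∀ (M : Type) [TopologicalSpace M] [T2Space M] [SecondCountableTopology M]
    [ChartedSpace (EuclideanSpace ℝ (Fin 4)) M] [IsManifold (𝓡 4) ∞ M] [CompactSpace M]
    [T3Space M] [MeasurableSpace M] [BorelSpace M],
    M ≃ₕ Metric.sphere (0 : EuclideanSpace ℝ (Fin 5)) 1 →
  ∀ (g : PseudoRiemannianMetric (𝓡 4) ∞ (EuclideanSpace ℝ (Fin 4)) (TangentSpace (𝓡 4) : M → Type _))
    [g.HasLeviCivita] (f : M → ℝ) (hg : g.IsRiemannian),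
    ContMDiff (𝓡 4) 𝓘(ℝ, ℝ) ∞ f →
    (∀ x : M, g.scalarCurvature x + g.gradSq f x = f x) →
    ENNReal.ofReal (32 * Real.pi ^ 2 * Real.sqrt Real.pi * Real.exp (-(3 : ℝ) / 2)) <
      ∫⁻ x, ENNReal.ofReal (Real.exp (-f x)) ∂(riemannianMeasure (g.toContMDiffRiemannianMetric hg)) →
    ∫ x, (g.scalarCurvature x - 2) ^ 2 ∂(riemannianMeasure (g.toContMDiffRiemannianMetric hg)) <
      2 * ((riemannianMeasure (g.toContMDiffRiemannianMetric hg)) Set.univ).toReal - 96 * Real.pi ^ 2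

/-- `0 < 36`. [folklore] -/
theorem thirtysix_pos : (0 : ℝ) < 36 := by norm_num

/-- **The big round sphere `S⁴(6)`** = `36 • g_{S⁴(1)}`: `R ≡ 1/3`, `Vol = 36² · 8π²/3 = 3456π²`. [folklore] -/
def bigSphereMetric :
    PseudoRiemannianMetric (𝓡 4) ∞ (EuclideanSpace ℝ (Fin 4)) (TangentSpace (𝓡 4) : SphereFour → Type _) :=
  (roundMetric (n := 4) EuclideanFive).constSmul 36 thirtysix_pos.ne'

/-- `36 • g_{S⁴}` is Riemannian. [folklore] -/
theorem isRiemannian_bigSphereMetric : bigSphereMetric.IsRiemannian :=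
  isRiemannian_roundMetric.constSmul thirtysix_pos

/-- Levi-Civita instance for `36 • g_{S⁴}`. [folklore] -/
instance instHasLeviCivitaBigSphere : bigSphereMetric.HasLeviCivita :=
  bigSphereMetric.hasLeviCivita

/-- Levi-Civita instance for `36 • g_{S⁴}` in unfolded form. [folklore] -/
instance instHasLeviCivitaRoundFourSmul36 :
    ((roundMetric (n := 4) EuclideanFive).constSmul 36 thirtysix_pos.ne').HasLeviCivita :=
  bigSphereMetric.hasLeviCivita

/-- **`R(S⁴(6)) = 12/36 = 1/3`.** [folklore] -/
theorem scalarCurvature_bigSphereMetric (y : SphereFour) : bigSphereMetric.scalarCurvature y = 1 / 3 := by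
  have h := (roundMetric (n := 4) EuclideanFive).scalarCurvature_constSmul 36 thirtysix_pos.ne' y
  rw [scalarCurvature_roundMetric] at h
  change bigSphereMetric.scalarCurvature y = _ at h
  rw [h]
  norm_num

/-- The volume of `S⁴(6)`: `dV(univ) = 36² · 8π²/3`. [folklore] -/
theorem volume_bigSphere :
    riemannianMeasure (bigSphereMetric.toContMDiffRiemannianMetric isRiemannian_bigSphereMetric) univ =
      ENNReal.ofReal ((36 : ℝ) ^ 2 * (8 * Real.pi ^ 2 / 3)) := by
  have h1 : riemannianMeasure (bigSphereMetric.toContMDiffRiemannianMetric isRiemannian_bigSphereMetric) univ =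
      bigSphereMetric.vol univ := by
    rw [PseudoRiemannianMetric.vol, riemVolume_eq isRiemannian_bigSphereMetric]
  have h2 : bigSphereMetric.vol univ = ENNReal.ofReal ((36 : ℝ) ^ 2) * (roundMetric (n := 4) EuclideanFive).vol univ :=
    vol_constSmul_four (roundMetric (n := 4) EuclideanFive) thirtysix_pos univ
  have h3 : (roundMetric (n := 4) EuclideanFive).vol univ = ENNReal.ofReal (8 * Real.pi ^ 2 / 3) := by
    rw [PseudoRiemannianMetric.vol, riemVolume_eq isRiemannian_roundMetric]
    exact riemannianMeasure_roundMetric_sphere_four_univ EuclideanFive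
  rw [h1, h2, h3, ← ENNReal.ofReal_mul (by positivity)]

/-- Numerics: the big sphere clears the density bar, `32π²√π e^{-3/2} < e^{-1/3} · 36² · 8π²/3`
(`√π < 2`, `e^{-3/2} < e^{-1/3}`, `64 < 3456`). [folklore] -/
theorem densityBound_lt_bigSphere :
    32 * Real.pi ^ 2 * Real.sqrt Real.pi * Real.exp (-(3 : ℝ) / 2) <
      Real.exp (-(1 / 3 : ℝ)) * ((36 : ℝ) ^ 2 * (8 * Real.pi ^ 2 / 3)) := by
  have hπ := Real.pi_pos
  have hs : Real.sqrt Real.pi < 2 := by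
    rw [Real.sqrt_lt' (by norm_num)]
    have := Real.pi_lt_d2
    nlinarith
  have he : Real.exp (-(3 : ℝ) / 2) < Real.exp (-(1 / 3 : ℝ)) := Real.exp_lt_exp.mpr (by norm_num)
  have hE := Real.exp_pos (-(3 : ℝ) / 2)
  have hp2 : 0 < Real.pi ^ 2 := by positivity
  calc 32 * Real.pi ^ 2 * Real.sqrt Real.pi * Real.exp (-(3 : ℝ) / 2)
      < 32 * Real.pi ^ 2 * 2 * Real.exp (-(3 : ℝ) / 2) := by
        apply mul_lt_mul_of_pos_right _ hE
        exact mul_lt_mul_of_pos_left hs (by positivity)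
    _ ≤ 32 * Real.pi ^ 2 * 2 * Real.exp (-(1 / 3 : ℝ)) := by
        apply mul_le_mul_of_nonneg_left he.le (by positivity)
    _ < Real.exp (-(1 / 3 : ℝ)) * ((36 : ℝ) ^ 2 * (8 * Real.pi ^ 2 / 3)) := by
        nlinarith [Real.exp_pos (-(1 / 3 : ℝ))]

/-- **`stub_varianceBudget` minus the soliton equation is FALSE**: on the standard `S⁴` take
`g = 36 g_{S⁴(1)}` (radius `6`) and `f ≡ 1/3 = R`; then `R + |∇f|² = f`, `∫ e^{-f} dV = e^{-1/3}·3456π² ≫ Z₀`,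
but `∫ (R − 2)² dV = (25/9)·Vol > 2·Vol − 96π²`. So any proof of the variance budget must use the
soliton PDE (the scale is otherwise free). [folklore] -/
theorem stub1WithoutSoliton_false : ¬ Stub1WithoutSoliton := by
  intro h
  have hnorm : ∀ x : SphereFour, bigSphereMetric.scalarCurvature x + bigSphereMetric.gradSq (fun _ ↦ (1 / 3 : ℝ)) x
      = (fun _ : SphereFour ↦ (1 / 3 : ℝ)) x := by
    intro x
    rw [scalarCurvature_bigSphereMetric, gradSq_const]
    norm_num
  have hdens : ENNReal.ofReal (32 * Real.pi ^ 2 * Real.sqrt Real.pi * Real.exp (-(3 : ℝ) / 2)) <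
      ∫⁻ x, ENNReal.ofReal (Real.exp (-(fun _ : SphereFour ↦ (1 / 3 : ℝ)) x))
        ∂(riemannianMeasure (bigSphereMetric.toContMDiffRiemannianMetric isRiemannian_bigSphereMetric)) := by
    simp only
    rw [lintegral_const, volume_bigSphere, ← ENNReal.ofReal_mul (Real.exp_pos _).le]
    exact (ENNReal.ofReal_lt_ofReal_iff (by positivity)).mpr densityBound_lt_bigSphere
  have h0 := h SphereFour (ContinuousMap.HomotopyEquiv.refl _) bigSphereMetric (fun _ ↦ (1 / 3 : ℝ))
    isRiemannian_bigSphereMetric contMDiff_const hnorm hdens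
  have hR : (fun x : SphereFour ↦ (bigSphereMetric.scalarCurvature x - 2) ^ 2) = fun _ ↦ (25 / 9 : ℝ) := by
    funext x
    rw [scalarCurvature_bigSphereMetric]
    norm_num
  rw [hR, integral_const, smul_eq_mul] at h0
  have hV : 0 ≤ (riemannianMeasure (bigSphereMetric.toContMDiffRiemannianMetric isRiemannian_bigSphereMetric)).real univ :=
    measureReal_nonneg
  have hpi : 0 < 96 * Real.pi ^ 2 := by positivity
  rw [Measure.real] at h0 hV
  nlinarith


/-! ## Non-vacuity / normalisation check of STUB 3's conclusion at the round shrinker -/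

/-- `|E|² ≡ 0` on `S⁴(√6)` (constant curvature, scaled). [folklore] -/
theorem tracelessRicciNormSq_shrinkingSphereFour (x : SphereFour) :
    shrinkingSphereFourMetric.tracelessRicciNormSq x = 0 := by
  have h : shrinkingSphereFourMetric.tracelessRicciNormSq x =
      (6 : ℝ)⁻¹ ^ 2 * (roundMetric (n := 4) EuclideanFive).tracelessRicciNormSq x :=
    (roundMetric (n := 4) EuclideanFive).tracelessRicciNormSq_constSmul six_pos' x
  rw [h, (hasConstantSectionalCurvatureWith_roundMetric EuclideanFive
      (roundMetric (n := 4) EuclideanFive).isLeviCivita_leviCivita_holds).tracelessRicciNormSq_eq_zero x,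
    mul_zero]

/-- `σ₂(A) ≡ 1/6` on `S⁴(√6)` (`= −½·0 + 2²/24`). [folklore] -/
theorem sigma2WeylSchouten_shrinkingSphereFour (x : SphereFour) :
    shrinkingSphereFourMetric.sigma2WeylSchouten x = 1 / 6 := by
  rw [shrinkingSphereFourMetric.sigma2WeylSchouten_eq (WithTop.coe_le_coe.mpr le_top) finrank_euclideanSpace_fin
      (fun v hv ↦ isRiemannian_shrinkingSphereFourMetric x v hv),
    tracelessRicciNormSq_shrinkingSphereFour, scalarCurvature_shrinkingSphereFourMetric]
  norm_num

/-- **STUB 3's conclusion holds at the round shrinker** `(S⁴(√6), f ≡ 2)`: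
`∫σ₂(A) dV = V/6 − (1/12)∫(R−2)² dV` reads `V/6 = V/6 − 0` (pins the `V/6` coefficient and the
`borel`/ambient-measure bridge `sigma2WeylSchoutenIntegral_eq` in Lean). [folklore] -/
theorem stub3_conclusion_round :
    shrinkingSphereFourMetric.sigma2WeylSchoutenIntegral =
      ((riemannianMeasure (shrinkingSphereFourMetric.toContMDiffRiemannianMetric
          isRiemannian_shrinkingSphereFourMetric)) Set.univ).toReal / 6 -
        (∫ x, (shrinkingSphereFourMetric.scalarCurvature x - 2) ^ 2
          ∂(riemannianMeasure (shrinkingSphereFourMetric.toContMDiffRiemannianMetric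
            isRiemannian_shrinkingSphereFourMetric))) / 12 := by
  rw [shrinkingSphereFourMetric.sigma2WeylSchoutenIntegral_eq isRiemannian_shrinkingSphereFourMetric]
  have h1 : (fun x : SphereFour ↦ shrinkingSphereFourMetric.sigma2WeylSchouten x) = fun _ ↦ (1 / 6 : ℝ) :=
    funext sigma2WeylSchouten_shrinkingSphereFour
  have h2 : (fun x : SphereFour ↦ (shrinkingSphereFourMetric.scalarCurvature x - 2) ^ 2) = fun _ ↦ (0 : ℝ) := by
    funext x
    rw [scalarCurvature_shrinkingSphereFourMetric]
    norm_num
  rw [h1, h2, integral_const, integral_zero, smul_eq_mul, Measure.real]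
  ring

end Summit.SmoothPoincare4.SmoothPoincare4.Cruxes.CompactShrinkerGap.DrefuteCgyVariancePivot

end
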